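import Summits.MatrixMultiplication.MatrixMultiplication.Theorems.ObstructionDescentInvariantTower

set_option linter.dupNamespace false

/-!
# Obstruction descent — block-extended Borel action and the restriction map (decomp-mm · lens 3 · gen 14, law H13, Part A)

Route `route-MatrixMultiplication-ObstructionDescent` (sub-problem `MatrixMultiplication`, `ω(ℂ) = 2`), rev 7 `3f9f51b758cc`;
support for the aside **`InvariantSaturation`** (item `stmt-MatrixMultiplication-32282`, the invariant tower) and its linear-scale
form **`BlockLinearSaturation`** (item `stmt-MatrixMultiplication-33327`).  Imports only the LANDED invariant-tower file; restates
no item.  This is the DEFINITIONAL half of the Levi restriction law H13; the law itself and its consequences for the levels of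
block points are Part B (`ObstructionDescentBlockRestriction`).

## Contents

Fix a format `m` and a sub-block size `N₂`; `B = {i | m ≤ i + N₂}` is the set of the LAST `N₂` indices and `B³` the cube of index
triples all in `B`.

* `mixT N₂ x y` — the tensor equal to `y` on `B³` and to `x` off it; `cubeLast N₂ x = x|_{B³}`; `blockDiag m N₂` — the
  BLOCK-DIAGONAL tensors (every non-zero entry has its indices all in `B` or all outside `B`: the shape `x_out ⊞ x_B` of the
  block points of the census).
* `restrictB N₂ x` — the RESTRICTION to the last block at the point `x`: the algebra endomorphism of `ℂ[ℂ^m ⊗ ℂ^m ⊗ ℂ^m]`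
  substituting the constant `x_p` for every coordinate `p ∉ B³`; `evalT_restrictB : (restrictB N₂ x f)(y) = f(mixT N₂ x y)`.
* `extendLast N₂ P = 1 ⊕ P_BB` — the block extension of a matrix (`P` on the `B`-rows, the identity elsewhere); it is Borel when
  `P` is (`extendLast_mem_borel`), and its `((k^N))`-character is the `((k^{N₂}))`-character of `P` for `N₂ ≤ N`
  (`weightChar_rectType_extendLast`) — the character identity behind H13.
* `isHomogeneous_of_eval_smul_ne_zero` — homogeneity read off the scalar torus (`g(s·y) = s^d g(y)` for all `s ≠ 0` forces `g`
  homogeneous of degree `d`); `sum_rectType`, `weightChar_rectType_scalar`, `actTensor_scalar_one_one` — the scalar torus has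
  `((k^N))³`-character `s^{kN}` in slot `0` and rescales every entry.
* `slotAct_zero_apply` / `slotAct_one_apply` / `slotAct_two_apply` — entry formulas of the one-slot actions.

All statements over `ℂ`; no `sorry`; standard axioms.
[cite: BurgisserIkenmeyer2017, §5 (5.2); BurgisserIkenmeyer2011, §3.1–3.2 (weight vectors, semi-invariance under the Borel)]
-/

noncomputable section

open scoped BigOperators
open Finset

namespace Summit.MatrixMultiplication.MatrixMultiplication.Theorems.ObstructionCalculus

open Literature.Computability.AlgebraicComplexity (actTensor actTensor_apply eval_smul_of_isHomogeneous)

/-! ### 0 · Homogeneity read off the scalar torus -/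

section Homogeneity

variable {σ : Type*}

/-- **Homogeneity from the scaling law on the torus.**  If `g(s·y) = s^d·g(y)` for all `s ≠ 0` and all `y`, then `g` is
homogeneous of degree `d` (compare coefficients of the univariate polynomial `s ↦ g(s·y) − s^d g(y)`, which has infinitely many
roots, and conclude that every homogeneous component of `g` of index `≠ d` vanishes identically).  The forward direction is
`Literature.Computability.AlgebraicComplexity.eval_smul_of_isHomogeneous`; the Literature converse
`…AlgebraicComplexity.isHomogeneous_of_eval_smul` (module `LMRDetIdealModuleProofs`, not in this file's import closure) assumes
the scaling law for ALL `s` including `0`, which the torus does not supply — whence this variant. [folklore] -/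
theorem isHomogeneous_of_eval_smul_ne_zero (g : MvPolynomial σ ℂ) (d : ℕ)
    (h : ∀ s : ℂ, s ≠ 0 → ∀ y : σ → ℂ, MvPolynomial.eval (s • y) g = s ^ d * MvPolynomial.eval y g) :
    g.IsHomogeneous d := by
  classical
  have hcomp : ∀ j ∈ Finset.range (g.totalDegree + 1), j ≠ d →
      MvPolynomial.homogeneousComponent j g = 0 := by
    intro j hj hjd
    refine MvPolynomial.IsHomogeneous.eq_zero_of_forall_eval_eq_zero
      (MvPolynomial.homogeneousComponent_isHomogeneous j g) fun y => ?_
    set P : Polynomial ℂ := (∑ i ∈ Finset.range (g.totalDegree + 1),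
        Polynomial.C (MvPolynomial.eval y (MvPolynomial.homogeneousComponent i g)) * Polynomial.X ^ i) -
      Polynomial.C (MvPolynomial.eval y g) * Polynomial.X ^ d with hP
    have hexp : ∀ s : ℂ, MvPolynomial.eval (s • y) g = ∑ i ∈ Finset.range (g.totalDegree + 1),
        s ^ i * MvPolynomial.eval y (MvPolynomial.homogeneousComponent i g) := by
      intro s
      conv_lhs => rw [← MvPolynomial.sum_homogeneousComponent g]
      rw [map_sum]
      exact Finset.sum_congr rfl fun i _ =>
        eval_smul_of_isHomogeneous (MvPolynomial.homogeneousComponent_isHomogeneous i g) s y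
    have hroot : ∀ s : ℂ, s ≠ 0 → P.IsRoot s := by
      intro s hs
      simp only [hP, Polynomial.IsRoot, Polynomial.eval_sub, Polynomial.eval_finsetSum, Polynomial.eval_mul,
        Polynomial.eval_C, Polynomial.eval_pow, Polynomial.eval_X]
      rw [sub_eq_zero]
      calc ∑ i ∈ Finset.range (g.totalDegree + 1),
            MvPolynomial.eval y (MvPolynomial.homogeneousComponent i g) * s ^ i
          = ∑ i ∈ Finset.range (g.totalDegree + 1),
              s ^ i * MvPolynomial.eval y (MvPolynomial.homogeneousComponent i g) :=
            Finset.sum_congr rfl fun i _ => mul_comm _ _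
        _ = MvPolynomial.eval (s • y) g := (hexp s).symm
        _ = s ^ d * MvPolynomial.eval y g := h s hs y
        _ = MvPolynomial.eval y g * s ^ d := mul_comm _ _
    have hP0 : P = 0 :=
      Polynomial.eq_zero_of_infinite_isRoot P
        (((Set.finite_singleton (0 : ℂ)).infinite_compl).mono fun s hs => hroot s (by simpa using hs))
    have hcoeff := congrArg (fun Q : Polynomial ℂ => Q.coeff j) hP0
    simp only [hP, Polynomial.coeff_sub, Polynomial.finsetSum_coeff, Polynomial.coeff_C_mul_X_pow,
      Polynomial.coeff_zero, Finset.sum_ite_eq, if_pos hj, if_neg hjd, sub_zero] at hcoeff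
    exact hcoeff
  have hg : MvPolynomial.homogeneousComponent d g = g := by
    conv_rhs => rw [← MvPolynomial.sum_homogeneousComponent g]
    by_cases hd : d ∈ Finset.range (g.totalDegree + 1)
    · rw [← Finset.add_sum_erase _ _ hd, Finset.sum_eq_zero (fun j hj =>
        hcomp j (Finset.mem_of_mem_erase hj) (Finset.ne_of_mem_erase hj)), add_zero]
    · rw [Finset.sum_eq_zero fun j hj => hcomp j hj fun hjd => hd (hjd ▸ hj)]
      refine MvPolynomial.homogeneousComponent_eq_zero _ _ ?_
      rw [Finset.mem_range, not_lt] at hd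
      omega
  rw [← hg]
  exact MvPolynomial.homogeneousComponent_isHomogeneous d g

end Homogeneity

/-! ### 1 · Blocks of the corner: types, characters, the block-extended Borel -/

section BlockRestriction

variable {m : ℕ}

/-- The exponents of a right-aligned rectangular type sum to `k·N` (`N ≤ m`). [bookkeeping] -/
theorem sum_rectType {N : ℕ} (hN : N ≤ m) (k : ℕ) (s : Fin 3) : ∑ i : Fin m, rectType m N k s i = k * N := by
  obtain ⟨d, rfl⟩ := Nat.exists_eq_add_of_le' hN
  rw [Fin.sum_univ_add]
  have h1 : ∀ i : Fin d, rectType (d + N) N k s (Fin.castAdd N i) = 0 := fun i => by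
    have hi := i.isLt
    simp only [rectType, Fin.val_castAdd]
    rw [if_neg (by omega)]
  have h2 : ∀ j : Fin N, rectType (d + N) N k s (Fin.natAdd d j) = k := fun j => by
    simp only [rectType, Fin.val_natAdd]
    rw [if_pos (by omega)]
  simp only [h1, h2, Finset.sum_const_zero, Finset.sum_const, Finset.card_univ, Fintype.card_fin,
    smul_eq_mul, zero_add]
  ring

/-- The rectangular character of a scalar matrix: `χ_{((k^N))}(c·1) = c^{kN}`. [bookkeeping] -/
theorem weightChar_rectType_scalar {N : ℕ} (hN : N ≤ m) (k : ℕ) (s : Fin 3) (c : ℂ) :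
    weightChar (rectType m N k s) (Matrix.diagonal fun _ : Fin m => c) = c ^ (k * N) := by
  rw [weightChar_diagonal, Finset.prod_pow_eq_pow_sum, sum_rectType hN]

/-- The scalar torus in slot `0` rescales every entry. [bookkeeping] -/
theorem actTensor_scalar_one_one (c : ℂ) (t : Tensor ℂ m) :
    actTensor (Matrix.diagonal fun _ : Fin m => c) (1 : Matrix (Fin m) (Fin m) ℂ) 1 t =
      fun a b e => c * t a b e := by
  rw [← Matrix.diagonal_one, actTensor_diagonal]
  funext a b e
  simp

/-- `mixT N₂ x y`: the tensor equal to `y` on the cube `B³` of the last-`N₂` block and to `x` off it. [bookkeeping] -/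
def mixT (N₂ : ℕ) (x y : Tensor ℂ m) : Tensor ℂ m := fun a b c =>
  if m ≤ (a : ℕ) + N₂ ∧ m ≤ (b : ℕ) + N₂ ∧ m ≤ (c : ℕ) + N₂ then y a b c else x a b c

/-- The cube projection `x|_{B³}` (zero off the cube of the last-`N₂` block). [bookkeeping] -/
def cubeLast (N₂ : ℕ) (x : Tensor ℂ m) : Tensor ℂ m := fun a b c =>
  if m ≤ (a : ℕ) + N₂ ∧ m ≤ (b : ℕ) + N₂ ∧ m ≤ (c : ℕ) + N₂ then x a b c else 0

/-- `mixT x x = x`. [bookkeeping] -/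
theorem mixT_self (N₂ : ℕ) (x : Tensor ℂ m) : mixT N₂ x x = x := by
  funext a b c
  unfold mixT
  split_ifs <;> rfl

/-- `mixT x (x|_{B³}) = x`. [bookkeeping] -/
theorem mixT_cubeLast (N₂ : ℕ) (x : Tensor ℂ m) : mixT N₂ x (cubeLast N₂ x) = x := by
  funext a b c
  unfold mixT cubeLast
  split_ifs <;> rfl

/-- The RESTRICTION to the last block at the point `x`: the algebra endomorphism of `ℂ[ℂ^m ⊗ ℂ^m ⊗ ℂ^m]` substituting the
constant `x_p` for every coordinate `p ∉ B³` and keeping the coordinates `p ∈ B³`; `(restrictB N₂ x f)(y) = f(mixT N₂ x y)`.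
[this node] -/
def restrictB (N₂ : ℕ) (x : Tensor ℂ m) : MvPolynomial (Idx m) ℂ →ₐ[ℂ] MvPolynomial (Idx m) ℂ :=
  MvPolynomial.aeval fun p : Idx m =>
    if m ≤ (p.1 : ℕ) + N₂ ∧ m ≤ (p.2.1 : ℕ) + N₂ ∧ m ≤ (p.2.2 : ℕ) + N₂ then MvPolynomial.X p
    else MvPolynomial.C (x p.1 p.2.1 p.2.2)

/-- Evaluation of the restriction: `(restrictB N₂ x f)(y) = f(mixT N₂ x y)`. [this node] -/
theorem evalT_restrictB (N₂ : ℕ) (x y : Tensor ℂ m) (f : MvPolynomial (Idx m) ℂ) :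
    evalT y (restrictB N₂ x f) = evalT (mixT N₂ x y) f := by
  unfold restrictB evalT
  rw [← AlgHom.comp_apply, MvPolynomial.comp_aeval]
  have key : (fun p : Idx m => (MvPolynomial.aeval fun q : Idx m => y q.1 q.2.1 q.2.2)
      (if m ≤ (p.1 : ℕ) + N₂ ∧ m ≤ (p.2.1 : ℕ) + N₂ ∧ m ≤ (p.2.2 : ℕ) + N₂ then MvPolynomial.X p
        else MvPolynomial.C (x p.1 p.2.1 p.2.2))) = fun p : Idx m => mixT N₂ x y p.1 p.2.1 p.2.2 := by
    funext p
    unfold mixT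
    split_ifs with hp
    · rw [MvPolynomial.aeval_X]
    · rw [MvPolynomial.aeval_C]
      rfl
  rw [key]

variable (m) in
/-- The BLOCK-DIAGONAL tensors for the last-`N₂` block: a non-zero entry has its three indices all inside `B` or all outside
`B` (the shape `x_out ⊞ x_B`). [bookkeeping] -/
def blockDiag (N₂ : ℕ) : Set (Tensor ℂ m) :=
  {x | ∀ a b c : Fin m, x a b c ≠ 0 →
    (m ≤ (a : ℕ) + N₂ ∧ m ≤ (b : ℕ) + N₂ ∧ m ≤ (c : ℕ) + N₂) ∨
      (¬ m ≤ (a : ℕ) + N₂ ∧ ¬ m ≤ (b : ℕ) + N₂ ∧ ¬ m ≤ (c : ℕ) + N₂)}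

/-- Membership in `blockDiag`, unfolded. [bookkeeping] -/
theorem mem_blockDiag {N₂ : ℕ} {x : Tensor ℂ m} : x ∈ blockDiag m N₂ ↔ ∀ a b c : Fin m, x a b c ≠ 0 →
    (m ≤ (a : ℕ) + N₂ ∧ m ≤ (b : ℕ) + N₂ ∧ m ≤ (c : ℕ) + N₂) ∨
      (¬ m ≤ (a : ℕ) + N₂ ∧ ¬ m ≤ (b : ℕ) + N₂ ∧ ¬ m ≤ (c : ℕ) + N₂) := Iff.rfl

/-- A block-diagonal tensor vanishes at every MIXED index triple. [bookkeeping] -/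
theorem apply_eq_zero_of_mem_blockDiag {N₂ : ℕ} {x : Tensor ℂ m} (hx : x ∈ blockDiag m N₂) {a b c : Fin m}
    (h : ¬ ((m ≤ (a : ℕ) + N₂ ∧ m ≤ (b : ℕ) + N₂ ∧ m ≤ (c : ℕ) + N₂) ∨
      (¬ m ≤ (a : ℕ) + N₂ ∧ ¬ m ≤ (b : ℕ) + N₂ ∧ ¬ m ≤ (c : ℕ) + N₂))) : x a b c = 0 := by
  by_contra hne
  exact h (mem_blockDiag.1 hx a b c hne)

/-- A sum `x + y` with `x` supported outside the cube and `y` inside it is block-diagonal. [bookkeeping] -/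
theorem add_mem_blockDiag {N₂ : ℕ} {x y : Tensor ℂ m}
    (hx : ∀ a b c : Fin m, x a b c ≠ 0 → ¬ m ≤ (a : ℕ) + N₂ ∧ ¬ m ≤ (b : ℕ) + N₂ ∧ ¬ m ≤ (c : ℕ) + N₂)
    (hy : ∀ a b c : Fin m, y a b c ≠ 0 → m ≤ (a : ℕ) + N₂ ∧ m ≤ (b : ℕ) + N₂ ∧ m ≤ (c : ℕ) + N₂) :
    x + y ∈ blockDiag m N₂ := by
  refine mem_blockDiag.2 fun a b c hne => ?_
  by_cases hxa : x a b c = 0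
  · have hya : y a b c ≠ 0 := by
      intro hy0
      apply hne
      change x a b c + y a b c = 0
      rw [hxa, hy0, add_zero]
    exact Or.inl (hy a b c hya)
  · exact Or.inr (hx a b c hxa)

/-- The BLOCK-EXTENDED matrix `1 ⊕ P_BB`: `P` on the rows of the last-`N₂` block, the identity on the other rows. [bookkeeping] -/
def extendLast (N₂ : ℕ) (P : Matrix (Fin m) (Fin m) ℂ) : Matrix (Fin m) (Fin m) ℂ :=
  fun i j => if m ≤ (i : ℕ) + N₂ then P i j else if i = j then 1 else 0

/-- Rows inside the block. [bookkeeping] -/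
theorem extendLast_apply_of_mem {N₂ : ℕ} (P : Matrix (Fin m) (Fin m) ℂ) {i : Fin m} (hi : m ≤ (i : ℕ) + N₂)
    (j : Fin m) : extendLast N₂ P i j = P i j := by
  unfold extendLast
  rw [if_pos hi]

/-- Rows outside the block. [bookkeeping] -/
theorem extendLast_apply_of_not_mem {N₂ : ℕ} (P : Matrix (Fin m) (Fin m) ℂ) {i : Fin m}
    (hi : ¬ m ≤ (i : ℕ) + N₂) (j : Fin m) : extendLast N₂ P i j = if i = j then 1 else 0 := by
  unfold extendLast
  rw [if_neg hi]

/-- The block extension of a Borel element is a Borel element. [bookkeeping] -/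
theorem extendLast_mem_borel {N₂ : ℕ} {P : Matrix (Fin m) (Fin m) ℂ} (hP : P ∈ borel m) :
    extendLast N₂ P ∈ borel m := by
  refine ⟨fun i j hji => ?_, fun i => ?_⟩
  · by_cases hi : m ≤ (i : ℕ) + N₂
    · rw [extendLast_apply_of_mem P hi]
      exact hP.1 i j hji
    · rw [extendLast_apply_of_not_mem P hi, if_neg (ne_of_gt hji)]
  · by_cases hi : m ≤ (i : ℕ) + N₂
    · rw [extendLast_apply_of_mem P hi]
      exact hP.2 i
    · rw [extendLast_apply_of_not_mem P hi, if_pos rfl]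
      exact one_ne_zero

/-- The `((k^N))`-character of the block extension is the `((k^{N₂}))`-character (`N₂ ≤ N`). [this node] -/
theorem weightChar_rectType_extendLast {N N₂ : ℕ} (hN : N₂ ≤ N) (k : ℕ) (s : Fin 3)
    (P : Matrix (Fin m) (Fin m) ℂ) :
    weightChar (rectType m N k s) (extendLast N₂ P) = weightChar (rectType m N₂ k s) P := by
  unfold weightChar
  refine Finset.prod_congr rfl fun i _ => ?_
  by_cases h₂ : m ≤ (i : ℕ) + N₂
  · have h₁ : m ≤ (i : ℕ) + N := le_trans h₂ (by omega)
    rw [extendLast_apply_of_mem P h₂]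
    simp only [rectType, if_pos h₁, if_pos h₂]
  · rw [extendLast_apply_of_not_mem P h₂, if_pos rfl]
    simp only [rectType, if_neg h₂, one_pow, pow_zero]

/-- Upper-triangularity across the block boundary: a `B`-row of a Borel element vanishes off the `B`-columns. [bookkeeping] -/
theorem borel_apply_eq_zero_of_blocks {P : Matrix (Fin m) (Fin m) ℂ} (hP : P ∈ borel m) {N₂ : ℕ} {i j : Fin m}
    (hi : m ≤ (i : ℕ) + N₂) (hj : ¬ m ≤ (j : ℕ) + N₂) : P i j = 0 :=
  hP.1 i j (Fin.lt_def.2 (by omega))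

/-! ### 2 · One-slot actions on mixed tensors -/

/-- Entries of the slot-`0` action. [bookkeeping] -/
theorem slotAct_zero_apply (X : Matrix (Fin m) (Fin m) ℂ) (t : Tensor ℂ m) (a b c : Fin m) :
    slotAct 0 X t a b c = ∑ a', X a a' * t a' b c := by
  rw [slotAct_zero, actTensor_apply]
  refine Finset.sum_congr rfl fun a' _ => ?_
  rw [Finset.sum_eq_single b]
  · rw [Finset.sum_eq_single c]
    · rw [Matrix.one_apply_eq, Matrix.one_apply_eq, mul_one, mul_one]
    · intro c' _ hc'
      rw [Matrix.one_apply_ne' hc', mul_zero, zero_mul]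
    · intro h
      exact absurd (Finset.mem_univ c) h
  · intro b' _ hb'
    refine Finset.sum_eq_zero fun c' _ => ?_
    rw [Matrix.one_apply_ne' hb', mul_zero, zero_mul, zero_mul]
  · intro h
    exact absurd (Finset.mem_univ b) h

/-- Entries of the slot-`1` action. [bookkeeping] -/
theorem slotAct_one_apply (X : Matrix (Fin m) (Fin m) ℂ) (t : Tensor ℂ m) (a b c : Fin m) :
    slotAct 1 X t a b c = ∑ b', X b b' * t a b' c := by
  rw [slotAct_one, actTensor_apply, Finset.sum_eq_single a]
  · refine Finset.sum_congr rfl fun b' _ => ?_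
    rw [Finset.sum_eq_single c]
    · rw [Matrix.one_apply_eq, Matrix.one_apply_eq, one_mul, mul_one]
    · intro c' _ hc'
      rw [Matrix.one_apply_ne' hc', mul_zero, zero_mul]
    · intro h
      exact absurd (Finset.mem_univ c) h
  · intro a' _ ha'
    refine Finset.sum_eq_zero fun b' _ => Finset.sum_eq_zero fun c' _ => ?_
    rw [Matrix.one_apply_ne' ha', zero_mul, zero_mul, zero_mul]
  · intro h
    exact absurd (Finset.mem_univ a) h

/-- Entries of the slot-`2` action. [bookkeeping] -/
theorem slotAct_two_apply (X : Matrix (Fin m) (Fin m) ℂ) (t : Tensor ℂ m) (a b c : Fin m) :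
    slotAct 2 X t a b c = ∑ c', X c c' * t a b c' := by
  rw [slotAct_two, actTensor_apply, Finset.sum_eq_single a]
  · rw [Finset.sum_eq_single b]
    · refine Finset.sum_congr rfl fun c' _ => ?_
      rw [Matrix.one_apply_eq, Matrix.one_apply_eq, one_mul, one_mul]
    · intro b' _ hb'
      refine Finset.sum_eq_zero fun c' _ => ?_
      rw [Matrix.one_apply_ne' hb', mul_zero, zero_mul, zero_mul]
    · intro h
      exact absurd (Finset.mem_univ b) h
  · intro a' _ ha'
    refine Finset.sum_eq_zero fun b' _ => Finset.sum_eq_zero fun c' _ => ?_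
    rw [Matrix.one_apply_ne' ha', zero_mul, zero_mul, zero_mul]
  · intro h
    exact absurd (Finset.mem_univ a) h

end BlockRestriction

end Summit.MatrixMultiplication.MatrixMultiplication.Theorems.ObstructionCalculus
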